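import Summits.ABC.IUTFork.Joshi.PrototypeJointModel
import Summits.ABC.IUTFork.Joshi.LogLinkTransportInduced
import HarnessLib

/-!
# A JOINT kernel model in which the Frobenius of `B` INDUCES the point-Frobenius ([J-IIp] §10.13 literally, at every point),
# together with a BIJECTIVE point-Frobenius, E-t2's `EtaPtTeich` (Lem. 6.10.1) and `LiftCosetsNotFrobStable` (Rmk. 7.4.3)
# — vacuity item W5 of the adversary's column, over E-t3's signature; a model, nothing more

Test-side support file of the abc-iut cell, block E «type Joshi's construction, test vs S» (rung LADDER-ABC:A2.E; seat abc-iut-E-t7,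
gen 5 — AUTHORS-FIRST in-fit item on this seat's [J-IIp] §10.13 lineage `Joshi/LogLinkFrobeniusTransport` p430819 /
`Joshi/LogLinkTransportInduced` p443043, answering the located signature gap **W5** of abc-iut-E-t50 g4's audit of E-t57's
`Joshi/PrototypeJointModel` p441701, HOME/STATUS 2026-08-26T12:02:38Z, abc-iut-E-cx-2's VACUITY column). Carriers and hypotheses BY NAME,
nothing restated: E-t3's `PeriodRingDatum` / `PrototypeDatum`, `Bphi`, `NoCommutingFieldIso`; E-t2's `EtaPtTeich` / `liftsOf` /
`LiftCosetsNotFrobStable` (`Joshi/MochizukiAnsatzLocal`); this seat's `FrobeniusTransport` / `CommonTarget` / `LogsCoincide` /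
`NoInsertedIso` (p430819) and §10.13 lemmas (p443043); E-t57's toolkit `JointModel.Pt` / `mk` / `frobPt` / `e` / `teichAt` (p441701).
Source: K. Joshi, arXiv:2303.01662v3 (`paper:arxiv-2303.01662`, render `HOME/lit/renders/Joshi-arxiv-2303.01662/pNNNN.txt`, «p.N l.M»;
bib `Joshi2023ATS2Local`; unrefereed — TYPED AS A CANDIDATE). TAKES NO SIDE on [IUTchIII] Cor. 3.12, on Joshi's claims, or on
Mochizuki's reports on them; a model exhibits joint satisfiability of TYPED hypotheses, nothing more; typed ≠ proved ≠ endorsed.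
Object-side file (E-PLAN R14: no `Cor312*`/`Thm311*` import); no FACT-LIST row consumed; no Prop hypothesis; nothing asserted.

PRINT. §10.13 (p.33 l.1–12): «If `𝔪_{y_n} ⊂ B` is the maximal ideal of `B` corresponding to `y_n` … then `ϕ(𝔪_{y_{n−1}}) = 𝔪_{ϕ(y_{n−1})} =
𝔪_{y_n}`. … `ϕ([a] − p) = [ϕ(a)] − p = [a^p] − p` generates the prime ideal corresponding to `ϕ(y_{n−1}) = y_n`.» — the Frobenius of
POINTS is INDUCED by the Frobenius `φ` of the ring `B` (a ring automorphism, [FF18]). §10.5 (p.31 l.40): «Let `η_{K_y} : B → K_y` be the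
canonical surjection». §10.15 (p.33 l.18–23): «each `y_n` represents a distinct pair `(K_{y_n}, K^♭_{y_n} ≃ ℂ_p^♭)` notably the fields
`K_{y_n} = ℂ_p` is fixed, but the tilting data … is not fixed». §6.10 (p.18 l.11–15) = E-t2's `EtaPtTeich` (`η_{K_{y_a}}([a]) = p`).
Rmk. 7.4.3 (p.21 l.32–35): «union of all such lifts `T_y + [x]` of `ξ` is not closed under Frobenius» = E-t2's `LiftCosetsNotFrobStable`.

THE GAP (E-t50 g4; kernel facts in its probe `HOME/plan/E/t50/audit/Probe_p441701.lean` d8f5754e071bc3c7, quoted, not imported): E-t3's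
signature has NO field tying `frob : B → B` to `frobY` / `eta`; p441701 (`EtaPtTeich` ∧ bijective `ϕ`) takes `φ := id` while `ϕ` moves
classes, so there `∃ y b, η_y b = 0 ∧ η_{ϕ(y)}(φ b) ≠ 0`, and `LiftCosetsNotFrobStable` is FALSE (`φ = id` stabilises every set). W5:
is «`EtaPtTeich` ∧ bijective `ϕ` ∧ (`φ_B` induces `ϕ`) [∧ `LiftCosetsNotFrobStable`]» jointly consistent with the typed signature at all?

THE MODEL `Induced.periodRingDatum p` = p441701's `JointModel.periodRingDatum p` with EXACTLY TWO data fields changed (points `Y := Q̄_p/∼`,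
`pt := [−]`, `ϕ([a]) := [a^p]`, exponent `e`, `K_y := Q̄_p` with `‖·‖^{sc e(y)}`, `B := Y → Q̄_p`, `η_y` = evaluation, the Hilbert-hotel
Teichmüller field `[x](y) := teichAt y x`, `T_y := {0}`, Galois trivial — all p441701's, BY NAME):
(i)  `frob b := b ∘ ϕ⁻¹` — a RING AUTOMORPHISM of `B` (`frobRingEquiv`), so `η_{ϕ(y)}(φ b) = b(ϕ⁻¹(ϕ y)) = η_y(b)` (`eta_frobY_frob`);
(ii) the norm read at the `ϕ`-FIXED point `[1]` (`ϕ[1] = [1^p] = [1]`) instead of `[p]`: `|b|_ρ := ‖b([1])‖`, so `|[x]|_ρ = |x|_F` is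
     p441701's (A1) at `[1]` (`sc e[1] = 1`) and `frob_norm_one` holds with EQUALITY.
Logical model, not arithmetic-faithful (as p441701 says of itself); continuity unmodelled (no topology in the signature).

RESULTS (at the ONE datum `Induced.prototypeDatum p`; `ℓ⋆ = 2`, `q_E := p^{10}`, `ξ := p` as in p441701). §4: `etaPtTeich`, `frobY_bijective`
(verbatim); `eta_frobY_frob`, so E-t50's sentence is FALSE here (`not_exists_eta_zero_frob_ne`); §10.13 in kernel form (`ker_comp_eq`) and
LITERALLY `φ(𝔪_y) = 𝔪_{ϕ(y)}` (`map_ker_eq`, via p443043) at EVERY point; p430819's `FrobeniusTransport` INHABITED everywhere (`transport`),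
its residue isomorphism `σ_y` being the IDENTITY of `Q̄_p` (`residueIso_apply`) while `|k|_{K_{ϕ(y)}} = |k|_{K_y}^p` (`absK_frobPt`) —
§10.15's «field fixed, tilting data not» in the model; by the lineage's lemmas: no (R-fix) horn anywhere (`no_rfix_horn`), Thm. 10.15.1 (3)
fails in both typed forms everywhere (`not_noCommutingFieldIso`, `not_noInsertedIso`). §5: `B^{φ=p} ≠ 0` — `eig(y) := e(y)⁻¹` has
`φ(eig) = p·eig` (`e(ϕ y) = p·e(y)`) and `eig([p]) = 1`, so at `y_r = [p^{1/p}]` the logarithm of `ϕ(y_r) = [p]` hits `1` (`hone_root`)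
and no common target with `p ≠ 1` has coinciding logarithms there (`not_logsCoincide_root`). §6: `liftCosetsNotFrobStable` — E-t2's
Rmk. 7.4.3 claim-Prop HOLDS (`φ([p])` is no Teichmüller lift: values at `[1]` give `‖x′‖ = ‖p‖`, at `[p] = ϕ([p^{1/p}])` give `‖x′‖ =
‖p‖^p`). §7 PACKAGED `etaPtTeich_and_frobY_bijective_and_induced`: **the W5 conjunction is JOINTLY CONSISTENT with E-t3's typed
signature.** NOT said: anything about [FF18]'s actual `B`, continuity, or which reading of Thm. 10.15.1 (3) print intends. [folklore]
-/

noncomputable section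

open Function Set

namespace Summit.ABC.IUTFork.Joshi.JointModel.Induced

variable (p : ℕ) [hp : Fact p.Prime]

/-! ## 0. `p`-adic bookkeeping (private local copies, as in p441701) -/

/-- `0 < ‖p‖ < 1` in `Q̄_p` (read off p441701's datum; the Literature version lives in a module not imported here). [folklore] -/
private theorem norm_p_pos_lt_one : 0 < ‖(p : PadicAlgCl p)‖ ∧ ‖(p : PadicAlgCl p)‖ < 1 := by
  have := (JointModel.periodRingDatum p).abs0_p
  rwa [show (JointModel.periodRingDatum p).abs0 = Model.absOne p from rfl, Model.absOne_apply] at this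

/-- `(p : Q̄_p) ≠ 0`. [folklore] -/
private theorem p_ne_zero : (p : PadicAlgCl p) ≠ 0 := norm_pos_iff.1 (norm_p_pos_lt_one p).1

/-! ## 1. The point-Frobenius as a permutation of `Y`; its fixed point `[1]`; `φ(b) := b ∘ ϕ⁻¹` as a ring automorphism of `B` -/

/-- p441701's bijective point-Frobenius `ϕ([a]) = [a^p]` as a permutation of `Y = Q̄_p/∼`. [folklore] -/
def frobEquiv : Pt p ≃ Pt p := Equiv.ofBijective (frobPt p) (frobPt_bijective p)

/-- `frobEquiv` IS `ϕ`. [folklore] -/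
@[simp] theorem frobEquiv_apply (y : Pt p) : frobEquiv p y = frobPt p y := rfl

/-- `ϕ(ϕ⁻¹ y) = y`. [folklore] -/
theorem frobPt_symm_apply (y : Pt p) : frobPt p ((frobEquiv p).symm y) = y := (frobEquiv p).apply_symm_apply y

/-- `ϕ⁻¹(ϕ y) = y`. [folklore] -/
theorem symm_apply_frobPt (y : Pt p) : (frobEquiv p).symm (frobPt p y) = y := (frobEquiv p).symm_apply_apply y

/-- **`[1]` is a fixed point of `ϕ`** (`[1^p] = [1]`), hence of `ϕ⁻¹` — whereas p441701's evaluation point `[p]` is moved by `ϕ`. [folklore] -/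
theorem symm_one : (frobEquiv p).symm (mk p 1) = mk p 1 := by
  rw [Equiv.symm_apply_eq, frobEquiv_apply, frobPt_mk, one_pow]

/-- `ϕ⁻¹[p] = [p^{1/p}]` (`ExpModel.rootP p p` is a chosen `p`-th root of `p` in `Q̄_p`). [folklore] -/
theorem symm_mk_p : (frobEquiv p).symm (mk p (p : PadicAlgCl p)) = mk p (ExpModel.rootP p p) := by
  rw [Equiv.symm_apply_eq, frobEquiv_apply, frobPt_mk, ExpModel.rootP_pow p hp.out.pos]

/-- **The model's Frobenius of `B = (Y → Q̄_p)`: `φ(b) := b ∘ ϕ⁻¹`, a RING AUTOMORPHISM** (precomposition with a bijection). [folklore] -/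
def frobRingEquiv : (Pt p → PadicAlgCl p) ≃+* (Pt p → PadicAlgCl p) where
  toFun b := b ∘ (frobEquiv p).symm
  invFun b := b ∘ (frobEquiv p)
  left_inv b := funext fun y => congr_arg b ((frobEquiv p).symm_apply_apply y)
  right_inv b := funext fun y => congr_arg b ((frobEquiv p).apply_symm_apply y)
  map_mul' _ _ := rfl
  map_add' _ _ := rfl

/-- `φ(b)(y) = b(ϕ⁻¹ y)`. [folklore] -/
@[simp] theorem frobRingEquiv_apply (b : Pt p → PadicAlgCl p) (y : Pt p) :
    frobRingEquiv p b y = b ((frobEquiv p).symm y) := rfl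

/-! ## 2. Exponent bookkeeping: `e[1] = 0` (junk class), `sc e[1] = 1`, `e(ϕ y) = p·e(y)`, `e[p^{1/p}] = 1/p` -/

/-- `e([1]) = 0`: `‖1‖ = 1` is outside `(0,1)`, so `expQ` takes its junk value. [folklore] -/
theorem e_one : e p (mk p 1) = 0 := by
  rw [e_mk]; unfold ExpModel.expQ
  exact if_neg (by rw [norm_one]; exact fun h => lt_irrefl _ h.2)

/-- `sc e([1]) = 1`. [folklore] -/
theorem sc_e_one : ExpModel.sc (e p (mk p 1)) = 1 := by
  rw [e_one]; unfold ExpModel.sc; exact if_neg (lt_irrefl _)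

/-- **`e(ϕ y) = p · e(y)`** for EVERY point (p441701's `e_mk` + the exponent model's `expQ_pow`, valid at junk classes too). [folklore] -/
theorem e_frobPt (y : Pt p) : e p (frobPt p y) = p * e p y := by
  induction y using Quotient.inductionOn with | h a => ?_
  change e p (mk p (a ^ p)) = p * e p (mk p a)
  rw [e_mk, e_mk, ExpModel.expQ_pow p a hp.out.ne_zero]

/-- `e([p^{1/p}]) = 1/p`. [folklore] -/
theorem e_root : e p (mk p (ExpModel.rootP p p)) = 1 / p := by
  have h := e_frobPt p (mk p (ExpModel.rootP p p))
  rw [frobPt_mk, ExpModel.rootP_pow p hp.out.pos, e_mk, ExpModel.expQ_p] at h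
  have hp0 : (p : ℚ) ≠ 0 := Nat.cast_ne_zero.2 hp.out.ne_zero
  rw [eq_div_iff hp0, mul_comm]
  exact h.symm

/-- `‖[x]([1])‖ = ‖x‖` (p441701's (A1) at the fixed point). [folklore] -/
theorem norm_teichAt_one (x : PadicAlgCl p) : ‖teichAt p (mk p 1) x‖ = ‖x‖ := by
  have h := norm_teichAt_rpow p (mk p 1) x
  rwa [sc_e_one, Real.rpow_one] at h

/-- `‖[x]([p])‖ = ‖x‖` (exponent `e[p] = 1`). [folklore] -/
theorem norm_teichAt_p (x : PadicAlgCl p) : ‖teichAt p (mk p (p : PadicAlgCl p)) x‖ = ‖x‖ := by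
  have h := norm_teichAt_rpow p (mk p (p : PadicAlgCl p)) x
  rwa [e_mk, ExpModel.expQ_p, ExpModel.sc_of_pos one_pos, Rat.cast_one, Real.rpow_one] at h

/-- `‖[x]([p^{1/p}])‖ = ‖x‖^p` (exponent `1/p`). [folklore] -/
theorem norm_teichAt_root (x : PadicAlgCl p) : ‖teichAt p (mk p (ExpModel.rootP p p)) x‖ = ‖x‖ ^ p := by
  have h := norm_teichAt_rpow p (mk p (ExpModel.rootP p p)) x
  have hpos : (0 : ℚ) < 1 / p := one_div_pos.2 (Nat.cast_pos.2 hp.out.pos)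
  rw [e_root, ExpModel.sc_of_pos hpos, show (((1 / p : ℚ)) : ℝ) = ((p : ℝ))⁻¹ by push_cast; ring] at h
  rw [← h, Real.rpow_inv_natCast_pow (norm_nonneg _) hp.out.ne_zero]

/-! ## 3. The datum: p441701's with `frob := (· ∘ ϕ⁻¹)` and the norm read at the `ϕ`-fixed point `[1]` -/

/-- **The induced-Frobenius joint-model period-ring datum** over E-t3's signature: LITERALLY p441701's `JointModel.periodRingDatum p`
by structure update, with the two data fields `norm`, `frob` replaced (module docstring (i)/(ii)) and the five proof fields that mention
them re-proved; every other field IS p441701's. [folklore] -/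
def periodRingDatum :
    PeriodRingDatum (PadicAlgCl p) (Pt p → PadicAlgCl p) (PadicAlgCl p) (Pt p) (fun _ => PadicAlgCl p) Unit :=
  { JointModel.periodRingDatum p with
    norm := fun _ b => ‖b (mk p 1)‖
    norm_nonneg := fun _ _ => norm_nonneg _
    norm_add_le := fun _ _ _ => PadicAlgCl.isNonarchimedean p _ _
    norm_teich := fun _ x _ _ => by
      show ‖teichAt p (mk p 1) x‖ = Model.absOne p x
      rw [Model.absOne_apply, norm_teichAt_one]
    frob := fun b => b ∘ (frobEquiv p).symm
    gal_norm_one := fun _ _ h => h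
    frob_norm_one := fun b h => by
      show ‖b ((frobEquiv p).symm (mk p 1))‖ ≤ 1
      rw [symm_one]; exact h
    T_norm_one := fun _ τ hτ => by rw [Set.mem_singleton_iff.1 hτ]; simp }

/-- **The induced-Frobenius joint-model prototype datum**: `ℓ⋆ = 2`, `q_E := p^{10}`, `ξ := p` (p441701's choices). [folklore] -/
def prototypeDatum :
    PrototypeDatum (PadicAlgCl p) (Pt p → PadicAlgCl p) (PadicAlgCl p) (Pt p) (fun _ => PadicAlgCl p) Unit where
  toPeriodRingDatum := periodRingDatum p
  lstar := 2
  one_le_lstar := by norm_num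
  q := (p : PadicAlgCl p) ^ 10
  abs0_q := by
    show 0 < Model.absOne p _ ∧ Model.absOne p _ < 1
    rw [Model.absOne_apply, norm_pow]
    exact ⟨pow_pos (norm_p_pos_lt_one p).1 _, pow_lt_one₀ (norm_nonneg _) (norm_p_pos_lt_one p).2 (by norm_num)⟩
  xi := p
  abs0_xi := by
    show Model.absOne p (p : PadicAlgCl p) = (Model.absOne p ((p : PadicAlgCl p) ^ 10)) ^ (1 / (2 * ((2 * 2 + 1 : ℕ) : ℝ)))
    rw [Model.absOne_apply, Model.absOne_apply, norm_pow]
    have h : (1 / (2 * ((2 * 2 + 1 : ℕ) : ℝ))) = ((10 : ℕ) : ℝ)⁻¹ := by norm_num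
    rw [h, Real.pow_rpow_inv_natCast (norm_nonneg _) (by norm_num)]

/-! ## 4. `EtaPtTeich`, bijective `ϕ`, and §10.13: `φ_B` INDUCES `ϕ` — kernel form, literal form, the transport, at every point -/

/-- **The point-Frobenius is a BIJECTION** (p441701 `frobPt_bijective`). [folklore] -/
theorem frobY_bijective : Bijective (prototypeDatum p).frobY := frobPt_bijective p

/-- **E-t2's `EtaPtTeich` HOLDS** (`η_{K_{y_a}}([a]) = [a]([a]) = p`; p441701 `teichAt_mk_self` — Teichmüller field unchanged). [folklore] -/
theorem etaPtTeich : (prototypeDatum p).EtaPtTeich := by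
  intro a ha0 ha1
  show teichAt p (mk p a) a = (p : PadicAlgCl p)
  exact teichAt_mk_self p ⟨norm_pos_iff.2 ha0, by rwa [show (prototypeDatum p).absF = Model.absOne p from rfl,
    Model.absOne_apply] at ha1⟩

/-- **`φ_B` INDUCES `ϕ` THROUGH `η`, pointwise: `η_{ϕ(y)}(φ b) = η_y(b)`** (`b(ϕ⁻¹(ϕ y)) = b(y)`). [folklore] -/
theorem eta_frobY_frob (y : Pt p) (b : Pt p → PadicAlgCl p) :
    (prototypeDatum p).eta ((prototypeDatum p).frobY y) ((prototypeDatum p).frob b) = (prototypeDatum p).eta y b := by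
  show b ((frobEquiv p).symm (frobPt p y)) = b y
  rw [symm_apply_frobPt]

/-- **E-t50's W5 sentence — «`∃ y b, η_y b = 0 ∧ η_{ϕ(y)}(φ b) ≠ 0`», TRUE at p441701 — is FALSE at this datum.** [folklore] -/
theorem not_exists_eta_zero_frob_ne :
    ¬ ∃ (y : Pt p) (b : Pt p → PadicAlgCl p), (prototypeDatum p).eta y b = 0 ∧
      (prototypeDatum p).eta ((prototypeDatum p).frobY y) ((prototypeDatum p).frob b) ≠ 0 :=
  fun ⟨y, b, h0, h1⟩ => h1 ((eta_frobY_frob p y b).trans h0)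

/-- **§10.13 in p430819's KERNEL form, at every point: `ker(η_{ϕ(y)} ∘ φ) = ker η_y`** (as ring maps `η_{ϕ(y)} ∘ φ = η_y`). [folklore] -/
theorem ker_comp_eq (y : Pt p) :
    RingHom.ker (((prototypeDatum p).eta ((prototypeDatum p).frobY y)).comp (frobRingEquiv p).toRingHom) =
      RingHom.ker ((prototypeDatum p).eta y) := by
  rw [show ((prototypeDatum p).eta ((prototypeDatum p).frobY y)).comp (frobRingEquiv p).toRingHom = (prototypeDatum p).eta y from
    RingHom.ext fun b => eta_frobY_frob p y b]

/-- Every `η_y` (evaluation) is onto (§10.5's «canonical surjection», in the model). [folklore] -/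
theorem eta_surjective (y : Pt p) : Surjective ((prototypeDatum p).eta y) := fun k => ⟨fun _ => k, rfl⟩

/-- **§10.13 LITERALLY, at every point: `φ(𝔪_y) = 𝔪_{ϕ(y)}`** as ideals of `B` (`Ideal.map`; p443043 `map_ker_eq_of_ker_comp_eq`,
`φ` onto). [folklore] -/
theorem map_ker_eq (y : Pt p) :
    Ideal.map (frobRingEquiv p).toRingHom (RingHom.ker ((prototypeDatum p).eta y)) =
      RingHom.ker ((prototypeDatum p).eta ((prototypeDatum p).frobY y)) :=
  PeriodRingDatum.map_ker_eq_of_ker_comp_eq (D := (prototypeDatum p).toPeriodRingDatum) (frobRingEquiv p).toRingHom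
    (frobRingEquiv p).surjective (ker_comp_eq p y)

/-- **p430819's HYPOTHESIS structure `FrobeniusTransport` is INHABITED at EVERY point** — explicitly: `frobHom := φ`, `η` onto,
`ker_eq` = `ker_comp_eq`. [folklore] -/
def transport (y : Pt p) : (prototypeDatum p).FrobeniusTransport y where
  frobHom := (frobRingEquiv p).toRingHom
  frobHom_eq _ := rfl
  eta_surj := eta_surjective p y
  eta_frob_surj := (eta_surjective p ((prototypeDatum p).frobY y)).comp (frobRingEquiv p).surjective
  ker_eq := ker_comp_eq p y

/-- `Nonempty` form, every point. [folklore] -/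
theorem nonempty_transport (y : Pt p) : Nonempty ((prototypeDatum p).FrobeniusTransport y) := ⟨transport p y⟩

/-- **The Frobenius-induced residue isomorphism `σ_y : K_y ≃+* K_{ϕ(y)}` (p430819 `residueIso`, first isomorphism theorem) is the
IDENTITY map of `Q̄_p`** in the model (`σ_y(η_y b) = η_{ϕ(y)}(φ b) = η_y b`, applied to a constant `b`) — print's §10.15 «the fields
`K_{y_n} = ℂ_p` is fixed» … [folklore] -/
theorem residueIso_apply (y : Pt p) (k : PadicAlgCl p) : (transport p y).residueIso k = k :=
  (transport p y).residueIso_eta (fun _ : Pt p => k)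

/-- … «but the tilting data is not fixed»: the valuation DOES change along `ϕ` — `|k|_{K_{ϕ(y)}} = |k|_{K_y}^p` at every admissible
point `y = [a]`, `0 < ‖a‖ < 1` (exponent `e(ϕ y) = p·e(y)`). So `σ_y = id` is a field isomorphism and NOT an isometry. [folklore] -/
theorem absK_frobPt {a : PadicAlgCl p} (ha : Adm p a) (k : PadicAlgCl p) :
    (prototypeDatum p).absK (frobPt p (mk p a)) k = ((prototypeDatum p).absK (mk p a) k) ^ p := by
  show ‖k‖ ^ ExpModel.sc (e p (frobPt p (mk p a))) = (‖k‖ ^ ExpModel.sc (e p (mk p a))) ^ p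
  have he : 0 < e p (mk p a) := by rw [e_mk]; exact ExpModel.expQ_pos p ha.1 ha.2
  have hpe : 0 < (p : ℚ) * e p (mk p a) := mul_pos (Nat.cast_pos.2 hp.out.pos) he
  rw [e_frobPt, ExpModel.sc_of_pos he, ExpModel.sc_of_pos hpe, Rat.cast_mul, Rat.cast_natCast, mul_comm,
    Real.rpow_mul_natCast (norm_nonneg _)]

/-- **No (R-fix) horn ANYWHERE in the model** (p443043 `no_rfix_horn_of_induced`: `φ` onto, every `η` onto, §10.13 literal at every
point): for every common target `I` at every point, «logarithms coincide ∧ log of `ϕ(y)` hits `1` ∧ `p ≠ 1`» is impossible — the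
reading under which print's `τ(1) = p` proof of Thm. 10.15.1 (3) goes through has no realisation here. [claim: Joshi2023ATS2Local, status: disputed] -/
theorem no_rfix_horn {C : Type} [Field C] (y : Pt p) (I : (prototypeDatum p).CommonTarget C y) :
    ¬ (PeriodRingDatum.LogsCoincide I ∧
        (∃ b ∈ (prototypeDatum p).Bphi, (prototypeDatum p).eta ((prototypeDatum p).frobY y) b = 1) ∧
        ((prototypeDatum p).p : C) ≠ 1) :=
  PeriodRingDatum.no_rfix_horn_of_induced (D := (prototypeDatum p).toPeriodRingDatum) (frobRingEquiv p).toRingHom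
    (fun _ => rfl) (frobRingEquiv p).surjective (eta_surjective p) (map_ker_eq p) y I

/-- E-t3's as-printed middle-row typing of Thm. 10.15.1 (3), `NoCommutingFieldIso y`, FAILS at every point (p430819
`not_noCommutingFieldIso_of_transport`). [claim: Joshi2023ATS2Local, status: disputed] -/
theorem not_noCommutingFieldIso (y : Pt p) : ¬ (prototypeDatum p).NoCommutingFieldIso y :=
  PeriodRingDatum.not_noCommutingFieldIso_of_transport _ (transport p y)

/-- The common-target typing of Thm. 10.15.1 (3), `NoInsertedIso I`, FAILS for every common target at every point (p443043
`not_noInsertedIso_of_map_ker_eq`). [claim: Joshi2023ATS2Local, status: disputed] -/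
theorem not_noInsertedIso {C : Type} [Field C] (y : Pt p) (I : (prototypeDatum p).CommonTarget C y) :
    ¬ PeriodRingDatum.NoInsertedIso I :=
  PeriodRingDatum.not_noInsertedIso_of_map_ker_eq (D := (prototypeDatum p).toPeriodRingDatum) (frobRingEquiv p).toRingHom
    (fun _ => rfl) (frobRingEquiv p).surjective (eta_surjective p y) (eta_surjective p _) (map_ker_eq p y) I

/-! ## 5. `B^{φ=p} ≠ 0`: the eigenfunction `e(y)⁻¹`; the logarithm hits `1` at `[p^{1/p}]`; no coinciding logarithms there -/

/-- **The eigenfunction** `eig(y) := e(y)⁻¹ ∈ Q̄_p` (`0` at the junk classes, where `e = 0`). [folklore] -/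
def eig : Pt p → PadicAlgCl p := fun y => ((e p y : ℚ) : PadicAlgCl p)⁻¹

/-- `eig(ϕ y) = p⁻¹ · eig(y)`. [folklore] -/
theorem eig_frobPt (y : Pt p) : eig p (frobPt p y) = ((p : PadicAlgCl p))⁻¹ * eig p y := by
  simp only [eig]
  rw [e_frobPt, Rat.cast_mul, Rat.cast_natCast, mul_inv]

/-- **`eig ∈ B^{φ=p}`**: `φ(eig) = eig ∘ ϕ⁻¹ = p · eig`. [folklore] -/
theorem eig_mem_Bphi : eig p ∈ (prototypeDatum p).Bphi := by
  show (eig p ∘ (frobEquiv p).symm) = ((p : ℕ) : Pt p → PadicAlgCl p) * eig p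
  funext y
  obtain ⟨y₀, rfl⟩ := (frobPt_bijective p).2 y
  show eig p ((frobEquiv p).symm (frobPt p y₀)) = (p : PadicAlgCl p) * eig p (frobPt p y₀)
  rw [symm_apply_frobPt, eig_frobPt, mul_inv_cancel_left₀ (p_ne_zero p)]

/-- `eig([p]) = 1` (`e[p] = 1`). [folklore] -/
theorem eig_mk_p : eig p (mk p (p : PadicAlgCl p)) = 1 := by
  simp only [eig]
  rw [e_mk, ExpModel.expQ_p, Rat.cast_one, inv_one]

/-- `eig ≠ 0`, so **`B^{φ=p} ≠ {0}`** in this model (contrast: `{0}` in E-t3's base model, where `φ = id`). [folklore] -/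
theorem exists_mem_Bphi_ne_zero : ∃ b ∈ (prototypeDatum p).Bphi, b ≠ 0 :=
  ⟨eig p, eig_mem_Bphi p, fun h => one_ne_zero (by rw [← eig_mk_p p, h]; rfl)⟩

/-- **The logarithm of `ϕ(y_r) = [p]` hits `1`** at `y_r := [p^{1/p}]`: `η_{[p]}(eig) = eig([p]) = 1` with `eig ∈ B^{φ=p}`. [folklore] -/
theorem hone_root :
    ∃ b ∈ (prototypeDatum p).Bphi, (prototypeDatum p).eta ((prototypeDatum p).frobY (mk p (ExpModel.rootP p p))) b = 1 :=
  ⟨eig p, eig_mem_Bphi p,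
    show eig p (frobPt p (mk p (ExpModel.rootP p p))) = 1 by rw [frobPt_mk, ExpModel.rootP_pow p hp.out.pos, eig_mk_p]⟩

/-- Hence at `y_r`, for every common target `C` with `p ≠ 1` in `C`, **the two logarithms do NOT coincide** (p443043
`not_logsCoincide_of_map_ker_eq`): only the (R-ϕ) situation occurs, as in E-t52's column models — here with `φ` bijective and
§10.13 literal everywhere. [claim: Joshi2023ATS2Local, status: disputed] -/
theorem not_logsCoincide_root {C : Type} [Field C] (hC : ((prototypeDatum p).p : C) ≠ 1)
    (I : (prototypeDatum p).CommonTarget C (mk p (ExpModel.rootP p p))) : ¬ PeriodRingDatum.LogsCoincide I :=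
  PeriodRingDatum.not_logsCoincide_of_map_ker_eq (D := (prototypeDatum p).toPeriodRingDatum) (frobRingEquiv p).toRingHom
    (fun _ => rfl) (frobRingEquiv p).surjective (eta_surjective p _) (eta_surjective p _) (map_ker_eq p _) I (hone_root p) hC

/-! ## 6. Rmk. 7.4.3: the lift cosets are NOT Frobenius-stable in this model -/

/-- **`φ([p])` is no Teichmüller lift**: if `[p] ∘ ϕ⁻¹ = [x′]` then at `[1]` (fixed by `ϕ`, exponent unchanged) `‖p‖ = ‖x′‖`, while at
`[p] = ϕ([p^{1/p}])` (exponents `1/p` and `1`) `‖p‖^p = ‖x′‖` — and `‖p‖^p < ‖p‖`. [folklore] -/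
theorem frob_teich_p_ne_teich (x' : PadicAlgCl p) :
    (prototypeDatum p).frob ((prototypeDatum p).teich (p : PadicAlgCl p)) ≠ (prototypeDatum p).teich x' := by
  intro h
  have h1 := congr_fun h (mk p 1)
  change teichAt p ((frobEquiv p).symm (mk p 1)) (p : PadicAlgCl p) = teichAt p (mk p 1) x' at h1
  rw [symm_one] at h1
  have hn1 : ‖(p : PadicAlgCl p)‖ = ‖x'‖ := by
    rw [← norm_teichAt_one p (p : PadicAlgCl p), h1, norm_teichAt_one]
  have h2 := congr_fun h (mk p (p : PadicAlgCl p))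
  change teichAt p ((frobEquiv p).symm (mk p (p : PadicAlgCl p))) (p : PadicAlgCl p) =
    teichAt p (mk p (p : PadicAlgCl p)) x' at h2
  rw [symm_mk_p] at h2
  have hn2 : ‖(p : PadicAlgCl p)‖ ^ p = ‖x'‖ := by
    rw [← norm_teichAt_root p (p : PadicAlgCl p), h2, norm_teichAt_p]
  rw [← hn1] at hn2
  exact absurd hn2 (pow_lt_self_of_lt_one₀ (norm_p_pos_lt_one p).1 (norm_p_pos_lt_one p).2 hp.out.one_lt).ne

/-- **E-t2's Rmk. 7.4.3 claim-Prop `LiftCosetsNotFrobStable` HOLDS in the model**: at `y = [p]`, `ξ := η_{[p]}([p])`, the lift `[p]`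
lies in the union of lift cosets of `ξ` but `φ([p])` does not (`T_y = {0}`, so a member of the union IS a Teichmüller lift `[x′]`).
FALSE at p441701 (`φ = id`), per E-t50 g4's probe. [claim: Joshi2023ATS2Local, status: disputed] -/
theorem liftCosetsNotFrobStable : (prototypeDatum p).LiftCosetsNotFrobStable := by
  refine ⟨mk p (p : PadicAlgCl p),
    (prototypeDatum p).eta (mk p (p : PadicAlgCl p)) ((prototypeDatum p).teich (p : PadicAlgCl p)), fun hsub => ?_⟩
  have hmem : (prototypeDatum p).teich (p : PadicAlgCl p) ∈
      (prototypeDatum p).liftsOf (mk p (p : PadicAlgCl p))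
        ((prototypeDatum p).eta (mk p (p : PadicAlgCl p)) ((prototypeDatum p).teich (p : PadicAlgCl p))) :=
    Set.mem_iUnion₂.2 ⟨(p : PadicAlgCl p), rfl, (prototypeDatum p).teich_mem_liftCoset _ _⟩
  obtain ⟨x', -, τ, hτ, hx'⟩ := Set.mem_iUnion₂.1 (hsub (Set.mem_image_of_mem (prototypeDatum p).frob hmem))
  have hτ0 : τ = 0 := hτ
  rw [hτ0, zero_add] at hx'
  exact frob_teich_p_ne_teich p x' hx'

/-! ## 7. Packaged: W5 answered — the four [J-IIp] hypotheses are jointly consistent with the typed signature -/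

/-- **PACKAGED (W5).** At ONE datum over E-t3's signature: E-t2's `EtaPtTeich` ∧ the point-Frobenius `ϕ` is BIJECTIVE ∧ the
Frobenius of `B` INDUCES `ϕ` (through `η`, pointwise; hence §10.13 in kernel form and LITERALLY at every point, for a ring
AUTOMORPHISM `φ` of `B` restricting to the signature's `frob`) ∧ p430819's `FrobeniusTransport` is inhabited at every point ∧ E-t2's
`LiftCosetsNotFrobStable` ∧ `B^{φ=p} ≠ 0`. A model exhibits joint satisfiability of TYPED hypotheses, nothing more; logical, not
arithmetic-faithful; continuity unmodelled. [folklore] -/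
theorem etaPtTeich_and_frobY_bijective_and_induced :
    (prototypeDatum p).EtaPtTeich ∧ Bijective (prototypeDatum p).frobY ∧
      (∀ (y : Pt p) (b : Pt p → PadicAlgCl p),
        (prototypeDatum p).eta ((prototypeDatum p).frobY y) ((prototypeDatum p).frob b) = (prototypeDatum p).eta y b) ∧
      (∃ φ : (Pt p → PadicAlgCl p) ≃+* (Pt p → PadicAlgCl p), (∀ b, φ b = (prototypeDatum p).frob b) ∧
        ∀ y : Pt p, Ideal.map φ.toRingHom (RingHom.ker ((prototypeDatum p).eta y)) =
          RingHom.ker ((prototypeDatum p).eta ((prototypeDatum p).frobY y))) ∧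
      (∀ y : Pt p, Nonempty ((prototypeDatum p).FrobeniusTransport y)) ∧
      (prototypeDatum p).LiftCosetsNotFrobStable ∧
      (∃ b ∈ (prototypeDatum p).Bphi, b ≠ 0) :=
  ⟨etaPtTeich p, frobY_bijective p, eta_frobY_frob p, ⟨frobRingEquiv p, fun _ => rfl, map_ker_eq p⟩, nonempty_transport p,
    liftCosetsNotFrobStable p, exists_mem_Bphi_ne_zero p⟩

end Summit.ABC.IUTFork.Joshi.JointModel.Induced

end
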